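import Literature.Analysis.FluidPDE.ForcedFourierPicardExists
import Literature.Analysis.FluidPDE.TaoH1LocalExistenceForcedAssembly
import HarnessLib

/-!
# Tao (2011/2013), Thm. 5.4 (ii) + (iv) WITH FORCING: the named fact
# `tao2011_smooth_local_existence_forced` HOLDS

Discharge of the Literature fact `Literature.Analysis.FluidPDE.tao2011_smooth_local_existence_forced`
(`TaoH1LocalExistenceForced.lean`; T. Tao, Anal. PDE 6 (2013) = arXiv:1108.1165, Thm. 5.4 = arXiv
Thm. 31 (ii)+(iv) with (i) and the note closing the proof of (iv), p. 18 — local existence of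
smooth solutions of the FORCED Navier–Stokes system with lifespan controlled by the `H¹` norms of
the datum and of the force) from the two halves of the forced Fourier–Picard engine:

* the Fourier-side EXISTENCE theorem `tao2011_sobolevMildForced_exists`
  (`ForcedFourierPicardExists`: forced weighted-`L²` Picard scheme `ForcedFourierDuhamelDefs → … →
  ForcedFourierPicardLimit`, the Fourier-side run of Tao's `X¹` contraction WITH the force, for
  force coefficients in the wide class of the Leray-projected transform of a Schwartz force), and
* the physical-space ASSEMBLY `tao2011_smooth_local_existence_forced_of_exists'`
  (`TaoH1LocalExistenceForcedAssembly`: datum transfer, force transfer `forceData` and its Leray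
  part, the classical half `IsSobolevMildForced.classical`, the raw-force gauge of the pressure).

No definitions, no named facts; the fact stays a `def`, users' `(h : …)` are fed `…_holds`.

## References

* T. Tao, arXiv:1108.1165 = Anal. PDE 6 (2013): Thm. 5.4 = arXiv Thm. 31 (p. 18) with the note
  closing its proof; (7) p. 3; Lemma 2.1 = arXiv Lemma 23 (p. 10); footnote 3 (p. 4). [Tao2011]
-/

noncomputable section

open MeasureTheory Set Function

namespace Literature.Analysis.FluidPDE

/-- **Tao 2011, Thm. 5.4 (ii) + (iv) WITH FORCING holds**: the named fact
`tao2011_smooth_local_existence_forced` (local existence of smooth solutions of the forced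
Navier–Stokes system on the closed slab `[0, T] × ℝ³` with `u, ∂ₜu, p ∈ L^∞_t H^k_x`,
`u ∈ C([0,T]; L²)`, under `(‖u₀‖_{H¹} + T sup_t ‖f(t)‖_{H¹})⁴ T ≤ c ν³`) is a theorem: the
Fourier-side existence `tao2011_sobolevMildForced_exists` fed into the physical-space assembly
`tao2011_smooth_local_existence_forced_of_exists'`.
[cite: Tao2011, Thm. 5.4 (ii)+(iv) (arXiv Thm. 31, p. 18)] -/
theorem tao2011_smooth_local_existence_forced_holds : tao2011_smooth_local_existence_forced := by
  obtain ⟨c₀, hc₀, h⟩ := tao2011_sobolevMildForced_exists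
  exact tao2011_smooth_local_existence_forced_of_exists' ⟨c₀, hc₀,
    fun ν T hν hT a ha _ b hbm hbt hbd hbdiv hbconj A B hA hB hH1a hH1b hsmall =>
      h hν hT ha hbm hbt hbd hbdiv hbconj hA hB hH1a hH1b hsmall⟩

end Literature.Analysis.FluidPDE

end
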